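import Summits.ResolutionOfSingularities.ResolutionOfSingularities.Theorems.EquisingularLiftEquisingularLiftNatCentreCodimOfFrames
import Summits.ResolutionOfSingularities.ResolutionOfSingularities.Theorems.EquisingularLiftEquisingularLiftNatQuasiRegularPairLocal
import Literature.AlgebraicGeometry.Resolution.EffectiveCartierStalks
import Literature.AlgebraicGeometry.Resolution.BlowupChartMembership
import Literature.AlgebraicGeometry.Resolution.CoefficientIdealRestriction
import Literature.AlgebraicGeometry.Resolution.RegularLocalRingsJacobian
import Literature.AlgebraicGeometry.Resolution.ResolutionOfSingularities
import HarnessLib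

/-!
# [OURS · L1 W4.5(b) · EL♮(3)] A REGULAR CURVE WITH QUASI-REGULAR 2-FRAMES ON A REGULAR CARTIER SURFACE `V(𝓔)` CUTS AN EFFECTIVE CARTIER
# DIVISOR ON `V(𝓔)` — brick (c4) of the embedded-lift round (TWENTIETH plumbing; crux `EquisingularLiftNatThree` = stmt-ResolutionOfSingularities-20148)

HONEST FRAMING. OURS (cell res-hironaka, crux chain w45b, slot W4.5(b)); NOT a statement of any manuscript; replaces the role of NOTHING in the
manuscript; AI-written, AI review is weaker than expert review. Helper `--supports stmt-ResolutionOfSingularities-20148 --as helper`. Object (B2) of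
res-L1-w45b-plan-1's DEAL 02:13:56Z; signature file res-L1-w45b-stub-4 g9 `L/res-L1-w45b-stub-4/CARTIER-curve-on-surface.sig.lean` (edff113d799bced2).

THE STATEMENT. `X` locally Noetherian and regular; `𝓔 ≤ C` ideal sheaves with `𝓔` an EFFECTIVE CARTIER divisor (the exceptional surface) whose subscheme
`V(𝓔)` is regular, and `C` (the lifted curve) having a quasi-regular 2-frame at every point of its support. Then `C·𝒪_{V(𝓔)} = C.comap 𝓔.subschemeι` is
an effective Cartier divisor on `V(𝓔)` (`isEffectiveCartier_comap_subschemeι_of_frames`). SIGNATURE NOTE (flagged to stub-4 on the bus): the sig file's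
hypothesis `(h𝓔p : ∀ z, (stalkIdeal 𝓔 z).IsPrincipal)` admits `𝓔_z = ⊥` (then `V(𝓔) = X` near `z` and the conclusion fails for any codimension-2 `C`), so
the Cartier hypothesis on `𝓔` (equivalently: principal AND non-zero stalks along `supp C`) is the honest form; the verbatim-shaped variant
`isEffectiveCartier_comap_subschemeι_of_le_of_frames` keeps `h𝓔p` and adds the non-vanishing `h𝓔nz`.

THE PROOF (stub-4's hint, stalkwise; [cite: GortzWedhorn2020, Thm. 11.40 (2)] [cite: StacksProject, Tag 01WS]). At `s ∈ V(𝓔)` over `x ∈ supp C`: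
`R = 𝒪_{X,x}` regular local (a domain), `C_x = (c₀, c₁)` quasi-regular, `𝓔_x = (e)` with `e ≠ 0`, `𝒪_{V(𝓔),s} ≅ R ⧸ (e)` regular. Write
`e = a₀c₀ + a₁c₁` (`𝓔 ≤ C`). If `a₀, a₁ ∈ 𝔪` then `e ∈ 𝔪·C_x ⊆ 𝔪²` and `R ⧸ (e)` would not be regular
(`not_isRegularLocalRing_quotient_span_singleton_of_mem_sq`) — so some `aᵢ` is a unit and `C_x = (e, c_j)` (`span_pair_eq_of_isUnit`). Hence
`C·𝒪_{V(𝓔),s} = (c̄_j)` (`stalkIdeal_comap_eq_map_stalkMap`, `e ↦ 0`), and `c̄_j ≠ 0` (else `C_x = (e)`, contradicting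
`span_ne_span_singleton_of_isQuasiRegular_pair`) is a non-zero-divisor of the domain `𝒪_{V(𝓔),s}`. Off `supp C` the stalk is the unit ideal.
Conclude by `isEffectiveCartier_iff_forall_mem_cartierLocus`.
-/

set_option linter.dupNamespace false -- mandated namespace `Summit.<Summit>.<Problem>` of this single-conjunct summit

noncomputable section

open CategoryTheory CategoryTheory.Limits AlgebraicGeometry TopologicalSpace Topology IsLocalRing
open Literature.AlgebraicGeometry.Resolution
open AlgebraicGeometry.Scheme.IdealSheafData

universe u

namespace Summit.ResolutionOfSingularities.ResolutionOfSingularities.Cruxes.EquisingularLiftNat.Sections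

namespace CurveOnSurfaceCartier

/-! ## Ring lemmas -/

/-- `Set.range c = {c 0, c 1}` for a pair. [folklore] bookkeeping. -/
theorem range_fin_two {α : Type u} (c : Fin 2 → α) : Set.range c = {c 0, c 1} := by
  ext a
  simp only [Set.mem_range, Set.mem_insert_iff, Set.mem_singleton_iff]
  constructor
  · rintro ⟨i, rfl⟩
    fin_cases i
    · exact Or.inl rfl
    · exact Or.inr rfl
  · rintro (rfl | rfl)
    · exact ⟨0, rfl⟩
    · exact ⟨1, rfl⟩

/-- If `e = a₀c₀ + a₁c₁` with `a₀` a unit then `(c₀, c₁) = (e, c₁)`. [folklore] -/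
theorem span_pair_eq_of_isUnit_left {R : Type u} [CommRing R] {a₀ a₁ c₀ c₁ e : R} (he : a₀ * c₀ + a₁ * c₁ = e) (ha : IsUnit a₀) :
    Ideal.span ({c₀, c₁} : Set R) = Ideal.span {e, c₁} := by
  obtain ⟨u, rfl⟩ := ha
  apply le_antisymm
  · rw [Ideal.span_le]
    rintro y (rfl | rfl)
    · -- `c₀ = u⁻¹ (e - a₁ c₁)`
      have : y = (↑u⁻¹ : R) * e + (-(↑u⁻¹ * a₁)) * c₁ := by
        rw [← he]
        have hu : (↑u⁻¹ : R) * ↑u = 1 := Units.inv_mul u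
        linear_combination (-(y : R)) * hu
      rw [this]
      exact Ideal.add_mem _ (Ideal.mul_mem_left _ _ (Ideal.subset_span (by simp)))
        (Ideal.mul_mem_left _ _ (Ideal.subset_span (by simp)))
    · exact Ideal.subset_span (by simp)
  · rw [Ideal.span_le]
    rintro y (rfl | rfl)
    · rw [← he]
      exact Ideal.add_mem _ (Ideal.mul_mem_left _ _ (Ideal.subset_span (by simp)))
        (Ideal.mul_mem_left _ _ (Ideal.subset_span (by simp)))
    · exact Ideal.subset_span (by simp)

/-- If `e = a₀c₀ + a₁c₁` with `a₁` a unit then `(c₀, c₁) = (e, c₀)`. [folklore] -/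
theorem span_pair_eq_of_isUnit_right {R : Type u} [CommRing R] {a₀ a₁ c₀ c₁ e : R} (he : a₀ * c₀ + a₁ * c₁ = e) (ha : IsUnit a₁) :
    Ideal.span ({c₀, c₁} : Set R) = Ideal.span {e, c₀} := by
  have he' : a₁ * c₁ + a₀ * c₀ = e := by rw [add_comm]; exact he
  rw [Set.pair_comm c₀ c₁]
  exact span_pair_eq_of_isUnit_left he' ha

/-- **The local core.** `R` regular local, `c = (c₀, c₁)` quasi-regular inside `𝔪`, `e ∈ (c₀, c₁)` non-zero with `R ⧸ (e)` regular: then for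
`j = 0` or `j = 1`, `(c₀, c₁) = (e, c_j)` and `c_j ∉ (e)`. [cite: GortzWedhorn2020, Thm. 11.40 (2)] [folklore] -/
theorem exists_span_pair_eq_of_regular_quotient {R : Type u} [CommRing R] [IsRegularLocalRing R] (c : Fin 2 → R)
    (hc : IsQuasiRegular c) (hcm : Ideal.span (Set.range c) ≤ maximalIdeal R) {e : R} (he0 : e ≠ 0)
    (heC : e ∈ Ideal.span (Set.range c)) (hreg : IsRegularLocalRing (R ⧸ Ideal.span ({e} : Set R))) :
    ∃ j : Fin 2, Ideal.span (Set.range c) = Ideal.span {e, c j} ∧ c j ∉ Ideal.span ({e} : Set R) := by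
  haveI := isDomain_of_isRegularLocalRing R
  rw [range_fin_two] at heC hcm ⊢
  obtain ⟨a₀, a₁, hea⟩ := Ideal.mem_span_pair.mp heC
  -- `e ∉ 𝔪²`
  have he2 : e ∉ maximalIdeal R ^ 2 := fun h2 =>
    not_isRegularLocalRing_quotient_span_singleton_of_mem_sq he0 h2 hreg
  -- some coefficient is a unit
  have hunit : IsUnit a₀ ∨ IsUnit a₁ := by
    by_cases hu₀ : IsUnit a₀
    · exact Or.inl hu₀
    by_cases hu₁ : IsUnit a₁
    · exact Or.inr hu₁
    exfalso
    have ha₀ : a₀ ∈ maximalIdeal R := (mem_maximalIdeal _).mpr hu₀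
    have ha₁ : a₁ ∈ maximalIdeal R := (mem_maximalIdeal _).mpr hu₁
    have hc₀ : c 0 ∈ maximalIdeal R := hcm (Ideal.subset_span (by simp))
    have hc₁ : c 1 ∈ maximalIdeal R := hcm (Ideal.subset_span (by simp))
    apply he2
    rw [← hea, pow_two]
    exact Ideal.add_mem _ (Ideal.mul_mem_mul ha₀ hc₀) (Ideal.mul_mem_mul ha₁ hc₁)
  -- the generator `c_j` is not in `(e)` (else `(c₀, c₁) = (e)`, contradicting quasi-regularity of the pair)
  have key : ∀ j : Fin 2, Ideal.span ({c 0, c 1} : Set R) = Ideal.span {e, c j} → c j ∉ Ideal.span ({e} : Set R) := by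
    intro j hj hcj
    apply span_ne_span_singleton_of_isQuasiRegular_pair c hc (by rw [range_fin_two]; exact hcm) e
    rw [range_fin_two, hj]
    apply le_antisymm
    · rw [Ideal.span_le]
      rintro y (rfl | rfl)
      · exact Ideal.subset_span rfl
      · exact hcj
    · exact Ideal.span_mono (by simp)
  rcases hunit with h0 | h1
  · exact ⟨1, span_pair_eq_of_isUnit_left hea h0, key 1 (span_pair_eq_of_isUnit_left hea h0)⟩
  · exact ⟨0, span_pair_eq_of_isUnit_right hea h1, key 0 (span_pair_eq_of_isUnit_right hea h1)⟩

/-- Image of `(e, c)` under a ring map killing `e` is `(f c)`. [folklore] -/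
theorem map_span_pair_eq_of_map_eq_zero {R S : Type u} [CommRing R] [CommRing S] (f : R →+* S) {e c : R} (he : f e = 0) :
    (Ideal.span ({e, c} : Set R)).map f = Ideal.span {f c} := by
  rw [Ideal.map_span, Set.image_insert_eq, Set.image_singleton, he, Ideal.span_insert_zero]

end CurveOnSurfaceCartier

open CurveOnSurfaceCartier

/-- **A regular curve with quasi-regular 2-frames on the regular EFFECTIVE CARTIER surface `V(𝓔)` is Cartier on `V(𝓔)`** (brick (c4) of the
embedded-lift round, honest form of the signature: `𝓔` Cartier). [cite: GortzWedhorn2020, Thm. 11.40 (2)] [cite: StacksProject, Tag 01WS] [OURS · L1 W4.5b] -/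
theorem isEffectiveCartier_comap_subschemeι_of_frames {X : Scheme.{0}} [IsLocallyNoetherian X] (hX : Scheme.IsRegular X)
    (𝓔 C : X.IdealSheafData) (h𝓔C : 𝓔 ≤ C) (h𝓔cart : IsEffectiveCartier 𝓔) (h𝓔reg : Scheme.IsRegular 𝓔.subscheme)
    (hCfr : ∀ x ∈ C.support, ∃ c : Fin 2 → X.presheaf.stalk x, Ideal.span (Set.range c) = stalkIdeal C x ∧ IsQuasiRegular c) :
    IsEffectiveCartier (C.comap 𝓔.subschemeι) := by
  haveI : IsLocallyNoetherian 𝓔.subscheme := LocallyOfFiniteType.isLocallyNoetherian 𝓔.subschemeι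
  rw [isEffectiveCartier_iff_forall_mem_cartierLocus]
  intro s
  by_cases hx : 𝓔.subschemeι s ∈ C.support
  · -- notation
    haveI : IsRegularLocalRing (X.presheaf.stalk (𝓔.subschemeι s)) := hX _
    haveI : IsDomain (X.presheaf.stalk (𝓔.subschemeι s)) := isDomain_of_isRegularLocalRing _
    haveI : IsRegularLocalRing (𝓔.subscheme.presheaf.stalk s) := h𝓔reg s
    haveI : IsDomain (𝓔.subscheme.presheaf.stalk s) := isDomain_of_isRegularLocalRing _
    obtain ⟨c, hcspan, hcq⟩ := hCfr _ hx
    obtain ⟨e, he, h𝓔e⟩ := h𝓔cart.exists_stalkIdeal_eq_span (𝓔.subschemeι s)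
    have he0 : e ≠ 0 := nonZeroDivisors.ne_zero he
    have hcm : Ideal.span (Set.range c) ≤ maximalIdeal _ := by
      rw [hcspan]; exact (mem_support_iff_stalkIdeal_le C _).mp hx
    have heC : e ∈ Ideal.span (Set.range c) := by
      rw [hcspan]
      exact stalkIdeal_mono h𝓔C _ (by rw [h𝓔e]; exact Ideal.mem_span_singleton_self e)
    -- the quotient map `π : 𝒪_{X,x} → 𝒪_{V(𝓔),s}`, surjective with kernel `(e)`
    set π := (𝓔.subschemeι.stalkMap s).hom with hπ
    have hπsurj : Function.Surjective π := 𝓔.subschemeι.stalkMap_surjective s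
    have hker : RingHom.ker π = Ideal.span {e} := by rw [hπ, ker_stalkMap_subschemeι, h𝓔e]
    have hreg : IsRegularLocalRing (X.presheaf.stalk (𝓔.subschemeι s) ⧸ Ideal.span ({e} : Set _)) :=
      IsRegularLocalRing.of_ringEquiv
        ((RingHom.quotientKerEquivOfSurjective hπsurj).symm.trans (Ideal.quotEquivOfEq hker))
    obtain ⟨j, hj, hcj⟩ := exists_span_pair_eq_of_regular_quotient c hcq hcm he0 heC hreg
    have hπe : π e = 0 := by rw [← RingHom.mem_ker, hker]; exact Ideal.mem_span_singleton_self e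
    refine ⟨π (c j), ?_, ?_⟩
    · -- non-zero-divisor: `π (c j) ≠ 0` in the domain `𝒪_{V(𝓔),s}`
      apply mem_nonZeroDivisors_of_ne_zero
      intro h0
      exact hcj (by rw [← hker]; exact h0)
    · rw [stalkIdeal_comap_eq_map_stalkMap, ← hcspan, hj]
      exact map_span_pair_eq_of_map_eq_zero π hπe
  · apply mem_cartierLocus_of_not_mem_support
    rw [support_comap]
    exact hx

/-- **The signature form** (res-L1-w45b-stub-4 `CARTIER-curve-on-surface.sig.lean`, VERBATIM binders) with the one extra hypothesis it needs,
`h𝓔nz` — the principal stalks of `𝓔` are NON-ZERO along `supp C` (automatic for the exceptional divisor, which is Cartier; without it the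
statement is false: `𝓔 = ⊥`, `C` any codimension-2 regular curve). [cite: GortzWedhorn2020, Thm. 11.40 (2)] [cite: StacksProject, Tag 01WS] [OURS · L1 W4.5b] -/
theorem isEffectiveCartier_comap_subschemeι_of_le_of_frames {X : Scheme.{0}} [IsLocallyNoetherian X] (hX : Scheme.IsRegular X)
    (𝓔 C : X.IdealSheafData) (h𝓔C : 𝓔 ≤ C) (h𝓔p : ∀ z : X, (stalkIdeal 𝓔 z).IsPrincipal) (h𝓔reg : Scheme.IsRegular 𝓔.subscheme)
    (hCfr : ∀ x ∈ C.support, ∃ c : Fin 2 → X.presheaf.stalk x, Ideal.span (Set.range c) = stalkIdeal C x ∧ IsQuasiRegular c)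
    (h𝓔nz : ∀ x ∈ C.support, stalkIdeal 𝓔 x ≠ ⊥) :
    IsEffectiveCartier (C.comap 𝓔.subschemeι) := by
  haveI : IsLocallyNoetherian 𝓔.subscheme := LocallyOfFiniteType.isLocallyNoetherian 𝓔.subschemeι
  rw [isEffectiveCartier_iff_forall_mem_cartierLocus]
  intro s
  by_cases hx : 𝓔.subschemeι s ∈ C.support
  · haveI : IsRegularLocalRing (X.presheaf.stalk (𝓔.subschemeι s)) := hX _
    haveI : IsDomain (X.presheaf.stalk (𝓔.subschemeι s)) := isDomain_of_isRegularLocalRing _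
    haveI : IsRegularLocalRing (𝓔.subscheme.presheaf.stalk s) := h𝓔reg s
    haveI : IsDomain (𝓔.subscheme.presheaf.stalk s) := isDomain_of_isRegularLocalRing _
    obtain ⟨c, hcspan, hcq⟩ := hCfr _ hx
    obtain ⟨e, h𝓔e⟩ := (h𝓔p (𝓔.subschemeι s)).principal
    have h𝓔e' : stalkIdeal 𝓔 (𝓔.subschemeι s) = Ideal.span {e} := h𝓔e
    have he0 : e ≠ 0 := by
      intro h0
      apply h𝓔nz _ hx
      rw [h𝓔e', h0, Ideal.span_singleton_eq_bot]
    have hcm : Ideal.span (Set.range c) ≤ maximalIdeal _ := by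
      rw [hcspan]; exact (mem_support_iff_stalkIdeal_le C _).mp hx
    have heC : e ∈ Ideal.span (Set.range c) := by
      rw [hcspan]
      exact stalkIdeal_mono h𝓔C _ (by rw [h𝓔e']; exact Ideal.mem_span_singleton_self e)
    set π := (𝓔.subschemeι.stalkMap s).hom with hπ
    have hπsurj : Function.Surjective π := 𝓔.subschemeι.stalkMap_surjective s
    have hker : RingHom.ker π = Ideal.span {e} := by rw [hπ, ker_stalkMap_subschemeι, h𝓔e']
    have hreg : IsRegularLocalRing (X.presheaf.stalk (𝓔.subschemeι s) ⧸ Ideal.span ({e} : Set _)) :=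
      IsRegularLocalRing.of_ringEquiv
        ((RingHom.quotientKerEquivOfSurjective hπsurj).symm.trans (Ideal.quotEquivOfEq hker))
    obtain ⟨j, hj, hcj⟩ := exists_span_pair_eq_of_regular_quotient c hcq hcm he0 heC hreg
    have hπe : π e = 0 := by rw [← RingHom.mem_ker, hker]; exact Ideal.mem_span_singleton_self e
    refine ⟨π (c j), ?_, ?_⟩
    · apply mem_nonZeroDivisors_of_ne_zero
      intro h0
      exact hcj (by rw [← hker]; exact h0)
    · rw [stalkIdeal_comap_eq_map_stalkMap, ← hcspan, hj]
      exact map_span_pair_eq_of_map_eq_zero π hπe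
  · apply mem_cartierLocus_of_not_mem_support
    rw [support_comap]
    exact hx

end Summit.ResolutionOfSingularities.ResolutionOfSingularities.Cruxes.EquisingularLiftNat.Sections

end
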